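import Mathlib
import Literature.Analysis.FluidPDE.SuitableWeakCongr
import Literature.Analysis.FluidPDE.SelfSimilarCollapseAnsatz
import HarnessLib

/-!
# Crux E `PowerGaugeEulerLiouville` (stmt-NavierStokesRegularity-19832): PRESSURE SLAVING is sharp in the quantifier —
# «for EVERY slice» is false in the class
# (lane «pressure slaving», refuter-proofing note; LEAD ns-typeII-p2 g11 10:21:09Z (4) text vs. 10:45:58Z (1); width seat ns-ezl-w3 g2)

Route `EulerZoomLiouville` (NavierStokesRegularity), crux E.  The slaving theorem `PressureSlaving.exists_profilePressure` identifies the pressure of an exactly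
self-similar member with the ansatz of a profile A.E. ON THE SLAB (equivalently on a.e. slice).  The originally keyed text «`∃ Q, ∀ τ < 0, p τ =ᵐ
selfSimilarCollapsePressure g 0 Q τ`» (EVERY slice) is FALSE inside the class, because the three crux hypotheses see the pressure only through space–time
integrals: the pressure may be modified on one slice `{τ₀} × ℝ³` without leaving the class.

* `PressureSlaving.zero_isSuitableWeakSolutionOn` / `…zero_hasWeakSpatialGradientOn` / `…gauge_zero_le` — the zero member `(0, 0, 0)` with constant `c = 0`;
* `PressureSlaving.oneSlicePressure_mem_class` — WITNESS: `u = 0`, `H = 0`, `c = 0` and the one-slice pressure `p τ x := if τ = −1 then 1 else 0` satisfy the three crux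
  hypotheses (for every `ρ`), and `u τ = selfSimilarCollapse g 0 0 τ` for every rate `g`;
* `PressureSlaving.not_forall_slice_slaving` — **NO profile `Q` has `p τ = selfSimilarCollapsePressure 1 0 Q τ` a.e. for EVERY `τ < 0`** (the slice `τ = −2` forces
  `Q = 0` a.e., the slice `τ = −1` forces `Q = 1` a.e.); hence the «every slice» form of pressure slaving fails for the class.

WHAT THIS IS NOT: not NS regularity, not the crux E, not a refutation of any registered decl — a sharpness note for the census bookkeeping of the crux CLASS 19832
(MODEL lattice); `--supports` stmt-19832. [folklore]
-/

noncomputable section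

-- flat `Theorems/<Route><Decl>…` files of one crux share the namespace of the crux (tree convention: `Summit.<S>.<S>.…`)
set_option linter.dupNamespace false

open MeasureTheory Set Filter Topology Metric Function TopologicalSpace
open scoped ENNReal NNReal InnerProductSpace RealInnerProductSpace

namespace Summit.NavierStokesRegularity.NavierStokesRegularity.Theorems.PowerGaugeEulerLiouville

open Literature.Analysis Literature.Analysis.FunctionSpaces Literature.Analysis.FluidPDE

namespace PressureSlaving

/-! ### The zero member -/

/-- The zero field has the zero weak spatial gradient on any open space–time region. [folklore] -/
theorem zero_hasWeakSpatialGradientOn (Q : Opens (ℝ × EuclideanSpace ℝ (Fin 3))) :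
    HasWeakSpatialGradientOn Q (0 : ℝ → EuclideanSpace ℝ (Fin 3) → EuclideanSpace ℝ (Fin 3))
      (0 : ℝ → EuclideanSpace ℝ (Fin 3) → EuclideanSpace ℝ (Fin 3) →L[ℝ] EuclideanSpace ℝ (Fin 3)) where
  locallyIntegrableOn := by
    show LocallyIntegrableOn (fun _ => (0 : EuclideanSpace ℝ (Fin 3))) _ _
    exact locallyIntegrableOn_const _
  locallyIntegrableOn_grad := by
    show LocallyIntegrableOn (fun _ => (0 : EuclideanSpace ℝ (Fin 3) →L[ℝ] EuclideanSpace ℝ (Fin 3))) _ _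
    exact locallyIntegrableOn_const _
  integral_fderiv_mul_inner_eq φ _ v w := by simp

/-- **The zero member**: `(u, p) = (0, 0)` is a suitable weak Euler solution (no force) on any open space–time region. [folklore] -/
theorem zero_isSuitableWeakSolutionOn (Q : Opens (ℝ × EuclideanSpace ℝ (Fin 3))) :
    IsSuitableWeakSolutionOn Q 0 0 (0 : ℝ → EuclideanSpace ℝ (Fin 3) → EuclideanSpace ℝ (Fin 3))
      (0 : ℝ → EuclideanSpace ℝ (Fin 3) → ℝ) where
  distributional := by
    refine ⟨?_, ?_, ?_, fun θ _ => by simp, fun ψ _ => by simp⟩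
    · show LocallyIntegrableOn (fun _ => (0 : EuclideanSpace ℝ (Fin 3))) _ _
      exact locallyIntegrableOn_const _
    · simp only [uncurry, Pi.zero_apply, norm_zero, ne_eq, OfNat.ofNat_ne_zero, not_false_eq_true, zero_pow]
      exact locallyIntegrableOn_const _
    · show LocallyIntegrableOn (fun _ => (0 : ℝ)) _ _
      exact locallyIntegrableOn_const _
  energyClass K _ _ := ⟨0, ae_of_all _ fun t => by simp⟩
  pressure K _ _ := by
    simp [ENNReal.zero_rpow_of_pos (by norm_num : (0 : ℝ) < 3 / 2)]
  localEnergy := ⟨0, zero_hasWeakSpatialGradientOn Q, fun K _ _ => by simp [frobeniusNormSq_zero], fun φ _ _ => by simp⟩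

/-- The gauge functional of the zero member vanishes. [folklore] -/
theorem gauge_zero_le (ρ a : ℝ) :
    ENNReal.ofReal (a ^ (2 * ρ)) * cknA a (0 : ℝ × EuclideanSpace ℝ (Fin 3))
          (0 : ℝ → EuclideanSpace ℝ (Fin 3) → EuclideanSpace ℝ (Fin 3)) +
        ENNReal.ofReal (a ^ ρ) * cknE a (0 : ℝ × EuclideanSpace ℝ (Fin 3))
          (0 : ℝ → EuclideanSpace ℝ (Fin 3) → EuclideanSpace ℝ (Fin 3) →L[ℝ] EuclideanSpace ℝ (Fin 3)) +
      ENNReal.ofReal (a ^ (2 * ρ)) * cknD a (0 : ℝ × EuclideanSpace ℝ (Fin 3)) (0 : ℝ → EuclideanSpace ℝ (Fin 3) → ℝ) ≤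
      ((0 : ℝ≥0) : ℝ≥0∞) := by
  have hA : cknA a (0 : ℝ × EuclideanSpace ℝ (Fin 3)) (0 : ℝ → EuclideanSpace ℝ (Fin 3) → EuclideanSpace ℝ (Fin 3)) = 0 := by
    unfold cknA
    simp
  have hE : cknE a (0 : ℝ × EuclideanSpace ℝ (Fin 3))
      (0 : ℝ → EuclideanSpace ℝ (Fin 3) → EuclideanSpace ℝ (Fin 3) →L[ℝ] EuclideanSpace ℝ (Fin 3)) = 0 := by
    unfold cknE
    simp [frobeniusNormSq_zero]
  have hD : cknD a (0 : ℝ × EuclideanSpace ℝ (Fin 3)) (0 : ℝ → EuclideanSpace ℝ (Fin 3) → ℝ) = 0 := by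
    unfold cknD
    simp [ENNReal.zero_rpow_of_pos (by norm_num : (0 : ℝ) < 3 / 2)]
  rw [hA, hE, hD]
  simp

/-! ### The one-slice witness -/

/-- The one-slice pressure `𝟙_{τ = −1}` vanishes a.e. on the slab (its support `{−1} × ℝ³` is Lebesgue-null). [folklore] -/
theorem oneSlicePressure_ae_eq_zero :
    ∀ᵐ z ∂(volume.restrict (Iio (0 : ℝ) ×ˢ (univ : Set (EuclideanSpace ℝ (Fin 3))))),
      uncurry (0 : ℝ → EuclideanSpace ℝ (Fin 3) → ℝ) z =
        uncurry (fun (τ : ℝ) (_ : EuclideanSpace ℝ (Fin 3)) => if τ = -1 then (1 : ℝ) else 0) z := by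
  have hnull : (volume : Measure (ℝ × EuclideanSpace ℝ (Fin 3))) ({(-1 : ℝ)} ×ˢ (univ : Set (EuclideanSpace ℝ (Fin 3)))) = 0 := by
    rw [Measure.volume_eq_prod, Measure.prod_prod, Real.volume_singleton, zero_mul]
  refine ae_restrict_of_ae ?_
  have h : ∀ᵐ z ∂(volume : Measure (ℝ × EuclideanSpace ℝ (Fin 3))), z ∉ ({(-1 : ℝ)} ×ˢ (univ : Set (EuclideanSpace ℝ (Fin 3)))) :=
    measure_eq_zero_iff_ae_notMem.1 hnull
  filter_upwards [h] with z hz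
  have hz1 : z.1 ≠ -1 := fun h1 => hz (mem_prod.2 ⟨h1, mem_univ _⟩)
  simp [uncurry, hz1]

/-- **THE WITNESS IS IN THE CLASS.**  `u = 0`, `H = 0`, `c = 0` and the one-slice pressure `p τ x := if τ = −1 then 1 else 0` satisfy the three crux hypotheses of
`EulerZoomLiouville.PowerGaugeEulerLiouville` (any `ρ`), and the velocity is exactly self-similar of every rate with the zero profile. [folklore] -/
theorem oneSlicePressure_mem_class (ρ g : ℝ) :
    IsSuitableWeakSolutionOn (slab (EuclideanSpace ℝ (Fin 3)) (Iio 0) isOpen_Iio) 0 0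
        (0 : ℝ → EuclideanSpace ℝ (Fin 3) → EuclideanSpace ℝ (Fin 3))
        (fun (τ : ℝ) (_ : EuclideanSpace ℝ (Fin 3)) => if τ = -1 then (1 : ℝ) else 0) ∧
      HasWeakSpatialGradientOn (slab (EuclideanSpace ℝ (Fin 3)) (Iio 0) isOpen_Iio)
        (0 : ℝ → EuclideanSpace ℝ (Fin 3) → EuclideanSpace ℝ (Fin 3))
        (0 : ℝ → EuclideanSpace ℝ (Fin 3) → EuclideanSpace ℝ (Fin 3) →L[ℝ] EuclideanSpace ℝ (Fin 3)) ∧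
      (∀ a : ℝ, 0 < a →
        ENNReal.ofReal (a ^ (2 * ρ)) * cknA a (0 : ℝ × EuclideanSpace ℝ (Fin 3))
              (0 : ℝ → EuclideanSpace ℝ (Fin 3) → EuclideanSpace ℝ (Fin 3)) +
            ENNReal.ofReal (a ^ ρ) * cknE a (0 : ℝ × EuclideanSpace ℝ (Fin 3))
              (0 : ℝ → EuclideanSpace ℝ (Fin 3) → EuclideanSpace ℝ (Fin 3) →L[ℝ] EuclideanSpace ℝ (Fin 3)) +
          ENNReal.ofReal (a ^ (2 * ρ)) * cknD a (0 : ℝ × EuclideanSpace ℝ (Fin 3))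
              (fun (τ : ℝ) (_ : EuclideanSpace ℝ (Fin 3)) => if τ = -1 then (1 : ℝ) else 0) ≤ ((0 : ℝ≥0) : ℝ≥0∞)) ∧
      (∀ τ : ℝ, τ < 0 → (0 : ℝ → EuclideanSpace ℝ (Fin 3) → EuclideanSpace ℝ (Fin 3)) τ =
        selfSimilarCollapse g 0 (0 : EuclideanSpace ℝ (Fin 3) → EuclideanSpace ℝ (Fin 3)) τ) := by
  refine ⟨(zero_isSuitableWeakSolutionOn _).congr_ae (ae_of_all _ fun _ => rfl) ?_, zero_hasWeakSpatialGradientOn _,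
    fun a _ => ?_, fun τ _ => by simp⟩
  · rw [coe_slab]
    exact oneSlicePressure_ae_eq_zero
  · -- the `D`-gauge of the witness equals that of the zero pressure
    have hD : cknD a (0 : ℝ × EuclideanSpace ℝ (Fin 3))
        (fun (τ : ℝ) (_ : EuclideanSpace ℝ (Fin 3)) => if τ = -1 then (1 : ℝ) else 0) =
        cknD a (0 : ℝ × EuclideanSpace ℝ (Fin 3)) (0 : ℝ → EuclideanSpace ℝ (Fin 3) → ℝ) := by
      unfold cknD
      congr 1
      refine lintegral_congr_ae ?_
      have hsub : parabolicCylinder a (0 : ℝ × EuclideanSpace ℝ (Fin 3)) ⊆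
          Iio (0 : ℝ) ×ˢ (univ : Set (EuclideanSpace ℝ (Fin 3))) := by
        rintro ⟨t, x⟩ hz
        rw [mem_parabolicCylinder] at hz
        exact mem_prod.2 ⟨by simpa using hz.1.2, mem_univ _⟩
      filter_upwards [ae_restrict_of_ae_restrict_of_subset hsub oneSlicePressure_ae_eq_zero] with z hz
      have hz' : (if z.1 = -1 then (1 : ℝ) else 0) = 0 := by simpa [uncurry] using hz.symm
      rw [hz']
      simp
    rw [hD]
    exact gauge_zero_le ρ a

/-- **PRESSURE SLAVING FAILS SLICE BY SLICE.**  For the class member of `oneSlicePressure_mem_class` (velocity `0 = selfSimilarCollapse 1 0 0 τ` for all `τ`) there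
is NO profile `Q` with `p τ = selfSimilarCollapsePressure 1 0 Q τ` a.e. on `ℝ³` for EVERY `τ < 0`: the slice `τ = −2` forces `Q = 0` a.e., the slice `τ = −1` forces
`Q = 1` a.e.  Hence the quantifier of `PressureSlaving.exists_profilePressure` («for a.e. `τ`» / a.e. on the slab) cannot be improved to «for every `τ`». [folklore] -/
theorem not_forall_slice_slaving :
    ¬ ∃ Q : EuclideanSpace ℝ (Fin 3) → ℝ, ∀ τ : ℝ, τ < 0 →
      (fun (_ : EuclideanSpace ℝ (Fin 3)) => if τ = -1 then (1 : ℝ) else 0) =ᵐ[volume]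
        selfSimilarCollapsePressure 1 0 Q τ := by
  rintro ⟨Q, hQ⟩
  -- the slice `τ = -2`: `Q (2⁻¹ • x) = 0` a.e., hence `Q = 0` a.e.
  have h2 := hQ (-2) (by norm_num)
  have h2' : ∀ᵐ x ∂(volume : Measure (EuclideanSpace ℝ (Fin 3))), Q ((1 / 2 : ℝ) • x) = 0 := by
    filter_upwards [h2] with x hx
    have hx' : (0 : ℝ) = selfSimilarCollapsePressure 1 0 Q (-2) x := by simpa using hx
    rw [selfSimilarCollapsePressure_apply] at hx'
    norm_num at hx'
    exact hx'.symm
  have hQ0 : ∀ᵐ y ∂(volume : Measure (EuclideanSpace ℝ (Fin 3))), Q y = 0 := by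
    have h := (Measure.quasiMeasurePreserving_smul (volume : Measure (EuclideanSpace ℝ (Fin 3)))
      (two_ne_zero : (2 : ℝ) ≠ 0)).ae h2'
    filter_upwards [h] with y hy
    simpa [smul_smul] using hy
  -- the slice `τ = -1`: `Q x = 1` a.e.
  have h1 := hQ (-1) (by norm_num)
  have hQ1 : ∀ᵐ x ∂(volume : Measure (EuclideanSpace ℝ (Fin 3))), Q x = 1 := by
    filter_upwards [h1] with x hx
    have hx' : (1 : ℝ) = selfSimilarCollapsePressure 1 0 Q (-1) x := by simpa using hx
    rw [selfSimilarCollapsePressure_apply] at hx'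
    norm_num at hx'
    exact hx'.symm
  -- contradiction: `0 = 1` on a set of full (nonzero) measure
  have hfalse : ∀ᵐ x ∂(volume : Measure (EuclideanSpace ℝ (Fin 3))), False := by
    filter_upwards [hQ0, hQ1] with x h0 h1
    rw [h0] at h1
    exact zero_ne_one h1
  rw [eventually_false_iff_eq_bot, ae_eq_bot] at hfalse
  exact (NeZero.ne (volume : Measure (EuclideanSpace ℝ (Fin 3)))) hfalse

end PressureSlaving

end Summit.NavierStokesRegularity.NavierStokesRegularity.Theorems.PowerGaugeEulerLiouville

end
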